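import Summits.HodgeConjecture.HodgeConjecture.Theorems.F0P6aCanonicalFrobeniusIdealBanalBridges   -- ★ LA3-p03 p847972: the `𝔞_can` bridges (§2 étale, §3 multiplicative), `absNorm_asIdeal_eq_of_card_quotient_smul`
import Literature.AlgebraicGeometry.AbelianSchemes.BanalBlockFrobeniusKernelLaw                    -- ★ p848099: `frobKernelBanal_of_lieSignature_zero` ∕ `…_of_conj_lieSignature_zero`
import Literature.AlgebraicGeometry.HodgeTheory.IntegralModelSpecialPointLieRank                     -- ★ p848175: `finrank_range_specialFibre_eq_zero_of_forall_ker_eq`, `blockFamily_map`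
import Literature.AlgebraicGeometry.AbelianSchemes.QuasiInverseSpreadStage                          -- ★ p847745 §3: `baseChangeHom_comp_eq_mulN`
import Literature.AlgebraicGeometry.AbelianSchemes.SerreTwistBaseChange                             -- ★ `DualPair.baseChangeHom_dualIsogenyOver_base`
import HarnessLib

/-!
# Crux `HLiu418` — P6 sub-line **F0-P6a**, spine row 38 (π2-G) `frobKernel_banal` PAID AT THE CANONICAL TWIST IDEAL, at every special point of the smooth proper model

Cell `hodgecm-mathlib` (D-0151), crux `stmt-HodgeConjecture-24832` (HLiu418), `--supports` only (count-neutral).  LA4-plan (g0) DEAL 02:40:12Z → LA4-p04 (g0)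
ORGAN #3 «ROW-38 WRAPPER AT `𝔞_can`» (LEAD F0P6-plan (g3) «M-57c»: the P-SIDE payment of `RGDInputsAt.frobKernel_banal`, GEN spine ED. 4 helper
`FrobKernelBanal₀ S Kc 𝓜 w h𝓨 e 𝒜 ρ p f 𝔞` :193).  THEOREMS ONLY (no definition, no `sorry`, no new named fact).

THE STATEMENT.  A `Theorems/` file may not import a `Cruxes/…/Lines` workfile, and `FrobKernelBanal₀`, `sch₀Of`, `act₀Of`, `red₀Of` live in Lines files; so the
head `frobKernelBanal_canTwistIdeal` is the TEXT of `FrobKernelBanal₀` with those `def`s δ-UNFOLDED and one quantifier WIDER: for a smooth proper integral model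
`𝓨` over `𝒪_{F,(w)}` (feeder: `𝓜.localise w`) and EVERY special point `x̄ : 𝓨_s(κ̄(w))` (feeder: `x̄ := red₀Of … y = 𝓨.geomReductionMap (thickeningLift e _ y)`),
with `A := (𝒜 ×_𝓨 𝓨_s) ×_{𝓨_s} x̄ = (𝒜.baseChange ιs).baseChange x̄.left` (= `sch₀Of`, an `abbrev`) and `ι(b) := ((act.baseChange ιs).baseChange x̄.left).i b`
(= `(act₀Of …).hom.hom.hom` by δ + `rfl`, ★ `homMk_baseChange_i_eq_fibreHom`): for every banal place `u ∣ p` (`u ≠ w, c•w`), every `n` and every `T`-point `t`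
of `A` killed by `𝔭_u^n`, **`t ≫ F^{(f)}_{A∕κ̄(w)} = 1 ↔ ∀ b ∈ 𝔞_can, t ≫ ι(b) = 1`**, where `𝔞_can = ∏_{τ : m τ ≠ 0, τ ∤ c•w} ker (residue ∘ τR τ)` is the canonical
twist ideal of a Frobenius (★ p847883 spelling; the payer KNOWS `twistIdeal γ_σ = 𝔞_can`).  HYPOTHESES BY VALUE, all UPSTAIRS over `𝓨.total`: the tuple
`(𝒜, act, D, pol)` with relative dimension `g`, ROSATI in the `PELSpreadAt.rosati` shape, the (P-1) row `polQuasiInv` unpacked (`p ∤ d`, `λ ≫ ν = [d]`), the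
Kottwitz rows of `PELKottLawAt` (`m`, `τR`, `τR_spec`, `m_count`, `m_pair`, `m_banal`, `m_unmixed`) with KOTTWITZ read at every `F̄_w`-point of the generic
fibre (the spine՚s `KottwitzΩ` body), and the arithmetic of `w` (`Fact p.Prime`, `CharP κ̄(w) p`, `0 < f`, `#(𝓞 F ⧸ 𝔭_{c•w}) = p^f`), `F ∕ ℚ` Galois, `c•w ≠ w`.

THE PROOF (per banal `u`).  Block data `(p) = 𝔭_u^e 𝔟` and idempotents `a_n` (★ (O-CRT) `exists_eq_pow_mul_coprime`, `exists_blockIdempotentFamily`).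
UNMIXED dichotomy: either every embedding inducing `u` has `m = 0` — then `𝔭_u^n ⊔ 𝔞_can = ⊤` (★ LA3-p03 bridge `pow_sup_prod_filter_ker_eq_top_of_forall_eq_zero`),
the `u`-block of `Lie A_x̄` vanishes (★ p848175 `finrank_range_specialFibre_eq_zero_of_forall_ker_eq`, the count-generic (S-T)), and the ÉTALE law ★ p848099
`frobKernelBanal_of_lieSignature_zero` concludes; or (★ `forall_ne_zero_of_unmixed`) every embedding inducing `u` has `m ≠ 0` — then `𝔭_u^n ⊔ 𝔞_can =
𝔭_u^n ⊔ (p^f)` (★ bridge `pow_sup_prod_filter_ker_eq_of_forall_ne_zero` + `N𝔭_w = p^f`), the signature VANISHES on the conjugate block `c•u` (§2: `τ ↦ c•u ⇒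
τ∘c ↦ u ⇒ m(τ∘c) = 2 ⇒ m τ = 0` by `m_pair`∕`m_banal`, ★ `ker_residue_restrict_comp_complexConj`), so the `c•u`-block of `Lie A_x̄` vanishes on the conjugate
family `a_n†` (★ `blockFamily_map` along `† = toRingHom c`, ★ p848175), the Rosati law and the (P-1) row descend to `x̄` (§1, ★ `DualPair.baseChangeHom_dualIsogenyOver_base`,
★ `baseChangeHom_comp_eq_mulN`), and the MULTIPLICATIVE law ★ p848099 `frobKernelBanal_of_conj_lieSignature_zero` concludes.

FEEDER (P-line v6g, row 38 at `red₀ y`): `fun σ hσ γ hγ y u hp hu₁ hu₂ n T t ht => (twistIdeal γ = 𝔞_can) ▸ frobKernelBanal_canTwistIdeal hw (𝓜.localise w) h𝓨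
hgF T.act T.dual T.pol T.rosati T.pChar hpd ν hν hf T.hfDeg m τR τR_spec m_count hK m_pair m_banal m_unmixed (red₀Of … y) u hp hu₁ hu₂ n t ht` — instances
`Fact T.pChar.Prime := ⟨T.hpChar.1⟩`, `CharP := T.charP₀`; `hK` = `KottwitzΩ` read on all points of the thickening (every `F̄_w`-point lies on a sheet).

HC_CM is proved only modulo the 7 printed citations (2 remaining named inputs hLiu418 24832, h413 24833) until rung 0 closes; nothing here changes a count.

[cite: Shimura1998, §13.1 Thm. 1 (pp. 97–99); §18.6 (p. 127)] [cite: RapoportSmithlingZhang2020Diagonal, §4.1 (4.6) p. 16 and p. 17]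
[cite: Kottwitz1992, §5 (pp. 389–391)] [cite: Tate1997FiniteFlatGroupSchemes, (3.7), §(3.8) pp. 145–146] [cite: MumfordFogartyKirwan1994, Ch. 6 §1 Cor. 6.8 (p. 118)]
-/

set_option autoImplicit false
set_option linter.dupNamespace false  -- `Summit.HodgeConjecture.HodgeConjecture.…` BY DESIGN (D-0017)

-- `(𝒜.baseChange ιs).baseChange x̄` vs `Over.pullback`, `toAffine.toAbelianVariety` etc. are definitional only above `instances` transparency
-- (as in ★ `IntegralModelSpecialPointLieSignature`, ★ `BanalBlockFrobeniusKernelLaw`).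
set_option backward.isDefEq.respectTransparency false

noncomputable section

open CategoryTheory CategoryTheory.Limits AlgebraicGeometry MonoidalCategory CartesianMonoidalCategory Polynomial
open scoped MonObj Pointwise
open NumberField IsDedekindDomain IsDedekindDomain.HeightOneSpectrum IsLocalRing
open Literature.NumberTheory.GaloisRepresentations (closureValuationSubring)
open Literature.NumberTheory.Automorphic
open Literature.NumberTheory.DiophantineGeometry
open Literature.NumberTheory.EllipticCurves (specGenericPoint)
open Literature.AlgebraicGeometry.Motives Literature.AlgebraicGeometry.Motives.AbelianVariety
open Literature.AlgebraicGeometry.AbelianSchemes Literature.AlgebraicGeometry.AbelianSchemes.AbelianSchemeOver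
open Literature.AlgebraicGeometry.HodgeTheory.RingAction
open Literature.RingTheory.DedekindDomain
open Summit.HodgeConjecture.HodgeConjecture.Theorems.F0P6aKottwitzCountAtSplitPlace
open Summit.HodgeConjecture.HodgeConjecture.Theorems.F0P6aCanonicalFrobeniusIdealCounts
open Summit.HodgeConjecture.HodgeConjecture.Theorems.F0P6aCanonicalFrobeniusIdealBanalBridges

universe v

namespace Summit.HodgeConjecture.HodgeConjecture.Theorems.F0P6aFrobKernelBanalAtCanonicalTwistIdeal

/-! ## §1 Base-change bookkeeping (the Rosati law and the (P-1) row descend to the special point) -/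

/-- **The Rosati law of a ring action base-changes** along any `g : S′ ⟶ S`: from `ι(a†) ≫ λ = λ ≫ ι(a)^∨` over `S` to the same law for
`act₀.baseChange g`, `baseChangeHom λ g` and the base-changed dual pair (★ `DualPair.baseChangeHom_dualIsogenyOver_base`; the W-dock՚s §4 lemma, re-proved here because
a `Theorems` file cannot import the W-dock). [cite: MumfordFogartyKirwan1994, Ch. 6 §1 Cor. 6.8 (p. 118)] [cite: Kottwitz1992, §5 (pp. 389–391)] -/
theorem rosati_baseChange {S S' : Scheme.{0}} (g : S' ⟶ S) {A₀ : AbelianSchemeOver S} {O : Type*} [CommRing O]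
    (act₀ : A₀.RingAction O) (D₀ : A₀.DualPair) (lam : A₀.X ⟶ D₀.hat.X) (star : O → O)
    (hRos : ∀ a, haveI := act₀.isMonHom_i a
      act₀.i (star a) ≫ lam = lam ≫ DualPair.dualIsogenyOver (act₀.i a) D₀ D₀) (a : O) :
    haveI := (act₀.baseChange g).isMonHom_i a
    (act₀.baseChange g).i (star a) ≫ baseChangeHom lam g =
      baseChangeHom lam g ≫ DualPair.dualIsogenyOver ((act₀.baseChange g).i a) (D₀.baseChange g) (D₀.baseChange g) := by
  haveI := act₀.isMonHom_i a
  have h := congrArg (fun f => (Over.pullback g).map f) (hRos a)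
  simp only [Functor.map_comp] at h
  change baseChangeHom (act₀.i (star a)) g ≫ baseChangeHom lam g =
    baseChangeHom lam g ≫ baseChangeHom (A := D₀.hat) (B := D₀.hat) (DualPair.dualIsogenyOver (act₀.i a) D₀ D₀) g at h
  rw [DualPair.baseChangeHom_dualIsogenyOver_base g (act₀.i a) D₀ D₀] at h
  exact h

/-! ## §2 The signature on the conjugate block of a multiplicative banal block vanishes -/

section Signature

variable {F : Type} [Field F] [NumberField F] [IsCMField F] (w : HeightOneSpectrum (𝓞 F))
  (τR : (F →+* AlgebraicClosure (w.adicCompletion F)) → (𝓞 F →+* ↥(closureValuationSubring (w.adicCompletion F))))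
  (hτR : ∀ (τ : F →+* AlgebraicClosure (w.adicCompletion F)) (x : 𝓞 F),
    ((τR τ x : ↥(closureValuationSubring (w.adicCompletion F))) : AlgebraicClosure (w.adicCompletion F)) = τ (x : F))
  (m : (F →+* AlgebraicClosure (w.adicCompletion F)) → ℕ)
  (hpair : ∀ τ : F →+* AlgebraicClosure (w.adicCompletion F),
    m τ + m (τ.comp ((IsCMField.complexConj F : F ≃ₐ[↥(maximalRealSubfield F)] F) : F →+* F)) = 2)
  (hbanal : ∀ τ : F →+* AlgebraicClosure (w.adicCompletion F),
      RingHom.ker ((residue ↥(closureValuationSubring (w.adicCompletion F))).comp (τR τ)) ≠ (w.asIdeal : Ideal (𝓞 F)) →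
      RingHom.ker ((residue ↥(closureValuationSubring (w.adicCompletion F))).comp (τR τ)) ≠
        (((IsCMField.complexConj F) • w).asIdeal : Ideal (𝓞 F)) →
      m τ = 0 ∨ m τ = 2)

include hτR hpair hbanal in
/-- **ON A MULTIPLICATIVE BANAL BLOCK THE CONJUGATE BLOCK IS ÉTALE (signature count `0` on `c • u`)**: if every embedding inducing the banal place `u` has
`m ≠ 0`, then every embedding `τ` inducing `c • u` has `m τ = 0` — `τ ∘ c` induces `c • (c • u) = u` (★ `ker_residue_restrict_comp_complexConj`, `c² = 1`), so
`m (τ ∘ c) ∈ {0, 2} ∖ {0}` (`m_banal`) and `m τ = 2 − m (τ ∘ c) = 0` (`m_pair`). [cite: RapoportSmithlingZhang2020Diagonal, §3.2 (3.8) p. 11, Rem. 3.6 (3.14) p. 13]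
[cite: Kottwitz1992, §5 (p. 390)] -/
theorem forall_eq_zero_complexConj_smul_of_forall_ne_zero (u : HeightOneSpectrum (𝓞 F)) (huw : u ≠ w) (huc : u ≠ (IsCMField.complexConj F) • w)
    (h2 : ∀ τ : F →+* AlgebraicClosure (w.adicCompletion F),
      RingHom.ker ((residue ↥(closureValuationSubring (w.adicCompletion F))).comp (τR τ)) = u.asIdeal → m τ ≠ 0)
    (τ : F →+* AlgebraicClosure (w.adicCompletion F))
    (hτ : RingHom.ker ((residue ↥(closureValuationSubring (w.adicCompletion F))).comp (τR τ)) = ((IsCMField.complexConj F) • u).asIdeal) :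
    m τ = 0 := by
  -- `τ ∘ c` induces `c • (c • u) = u`
  have hτc : RingHom.ker ((residue ↥(closureValuationSubring (w.adicCompletion F))).comp
      (τR (τ.comp ((IsCMField.complexConj F : F ≃ₐ[↥(maximalRealSubfield F)] F) : F →+* F)))) = u.asIdeal := by
    have hcc : IsCMField.complexConj F * IsCMField.complexConj F = 1 := by
      conv_lhs => lhs; rw [← complexConj_inv (F := F)]
      exact inv_mul_cancel _
    rw [ker_residue_restrict_comp_complexConj w τR hτR τ, hτ, HeightOneSpectrum.smul_asIdeal, smul_smul, hcc, one_smul]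
  have hne := h2 _ hτc
  have huw' : u.asIdeal ≠ w.asIdeal := fun h => huw (HeightOneSpectrum.ext h)
  have huc' : u.asIdeal ≠ ((IsCMField.complexConj F) • w).asIdeal := fun h => huc (HeightOneSpectrum.ext h)
  have hb := hbanal _ (hτc ▸ huw') (hτc ▸ huc')
  have hp := hpair τ
  omega

end Signature

/-! ## §3 THE HEAD: row 38 `frobKernel_banal` at the canonical twist ideal, at every special point of the smooth proper model -/

/-- **HEAD — ROW 38 (π2-G) `frobKernel_banal` AT THE CANONICAL TWIST IDEAL, AT EVERY SPECIAL POINT.**  The TEXT of the spine՚s `FrobKernelBanal₀ … 𝔞_can`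
with `sch₀Of`∕`act₀Of`∕`red₀Of` δ-unfolded (see the module docstring for the dictionary and the feeder line): for a smooth proper integral model `𝓨` over
`𝒪_{F,(w)}`, a PEL tuple `(𝒜, act, D, pol)` over `𝓨.total` with ROSATI, a quasi-inverse `λ ≫ ν = [d]` with `p ∤ d`, Kottwitz rows `(m, τR)` with the count,
`m_pair`, `m_banal`, `m_unmixed`, and KOTTWITZ at every `F̄_w`-point of the generic fibre; then at every `x̄ ∈ 𝓨_s(κ̄(w))`, every banal `u ∣ p` (`u ≠ w, c•w`),
every `n` and every `T`-point `t` of `(𝒜 ×_𝓨 𝓨_s)_x̄` killed by `𝔭_u^n`: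
`t ≫ F^{(f)} = 1 ↔ ∀ b ∈ 𝔞_can, t ≫ ι(b) = 1`.  Étale blocks by ★ p848099 head 1 + ★ p848175 + ★ p847972 §2; multiplicative blocks by ★ p848099 head 2 +
★ p848175 on the conjugate family + ★ p847972 §3 + §1–§2 here. [cite: Shimura1998, §13.1 Thm. 1 (pp. 97–99); §18.6 (p. 127)]
[cite: RapoportSmithlingZhang2020Diagonal, §4.1 (4.6) p. 16 and p. 17] [cite: Kottwitz1992, §5 (pp. 389–391)] [cite: Tate1997FiniteFlatGroupSchemes, (3.7), §(3.8) pp. 145–146] -/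
theorem frobKernelBanal_canTwistIdeal {F : Type} [Field F] [NumberField F] [IsCMField F] [IsGalois ℚ F]
    {w : HeightOneSpectrum (𝓞 F)} (hw : (IsCMField.complexConj F) • w ≠ w)
    {X : SchemeOver F} (𝓨 : IntegralModel (valuationSubringAtPrime F w) F X) {dY : ℕ} (h𝓨 : 𝓨.IsSmoothProper dY)
    {𝒜 : AbelianSchemeOver 𝓨.total.left} {g : ℕ} (hg : 𝒜.IsOfRelDim g)
    (act : RingAction (𝓞 F) 𝒜) (D : 𝒜.DualPair) (pol : 𝒜.Polarization D)
    (hRos : ∀ b b' : 𝓞 F, (b' : F) = (IsCMField.complexConj F) (b : F) →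
      haveI := act.isMonHom b
      act.i b' ≫ pol.lam = pol.lam ≫ DualPair.dualIsogenyOver (act.i b) D D)
    (p : ℕ) [Fact p.Prime] [CharP (geomResidueField w) p] {d : ℕ} (hpd : p.Coprime d)
    (ν : D.hat.X ⟶ 𝒜.X) [IsMonHom ν] (hν : pol.lam ≫ ν = 𝒜.mulN d)
    {f : ℕ} (hf : 0 < f) (hfDeg : Nat.card (𝓞 F ⧸ ((IsCMField.complexConj F) • w).asIdeal) = p ^ f)
    (m : (F →+* AlgebraicClosure (w.adicCompletion F)) → ℕ)
    (τR : (F →+* AlgebraicClosure (w.adicCompletion F)) → (𝓞 F →+* ↥(closureValuationSubring (w.adicCompletion F))))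
    (hτR : ∀ (τ : F →+* AlgebraicClosure (w.adicCompletion F)) (x : 𝓞 F),
      ((τR τ x : ↥(closureValuationSubring (w.adicCompletion F))) : AlgebraicClosure (w.adicCompletion F)) = τ (x : F))
    (hcount : ∑ τ ∈ (Finset.univ.filter fun τ : F →+* AlgebraicClosure (w.adicCompletion F) =>
        RingHom.ker ((residue ↥(closureValuationSubring (w.adicCompletion F))).comp (τR τ)) =
          (((IsCMField.complexConj F) • w).asIdeal : Ideal (𝓞 F))), m τ = 1)
    (hK : haveI : IsProper 𝓨.total.hom := h𝓨.2
      ∀ (y : AlgPoints X (AlgebraicClosure (w.adicCompletion F))) (b : 𝓞 F),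
      letI ιη := 𝓨.genericIso'.inv.left ≫ pullback.fst 𝓨.total.hom (specGenericPoint (valuationSubringAtPrime F w) F)
      haveI := ((act.baseChange ιη).baseChange y.left).isMonHom_i b
      (cotangentMap ((𝒜.baseChange ιη).baseChange y.left).toAffine.toAbelianVariety
          (InducedCategory.homMk (Grp.ofHom (A := ((𝒜.baseChange ιη).baseChange y.left).X) (B := ((𝒜.baseChange ιη).baseChange y.left).X)
            (((act.baseChange ιη).baseChange y.left).i b)))).charpoly =
        ∏ τ : (F →+* AlgebraicClosure (w.adicCompletion F)), (Polynomial.X - Polynomial.C (τ (b : F))) ^ (m τ))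
    (hpair : ∀ τ : F →+* AlgebraicClosure (w.adicCompletion F),
      m τ + m (τ.comp ((IsCMField.complexConj F : F ≃ₐ[↥(maximalRealSubfield F)] F) : F →+* F)) = 2)
    (hbanal : ∀ τ : F →+* AlgebraicClosure (w.adicCompletion F),
      RingHom.ker ((residue ↥(closureValuationSubring (w.adicCompletion F))).comp (τR τ)) ≠ (w.asIdeal : Ideal (𝓞 F)) →
      RingHom.ker ((residue ↥(closureValuationSubring (w.adicCompletion F))).comp (τR τ)) ≠
        (((IsCMField.complexConj F) • w).asIdeal : Ideal (𝓞 F)) →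
      m τ = 0 ∨ m τ = 2)
    (hunmixed : ∀ τ τ' : F →+* AlgebraicClosure (w.adicCompletion F),
      RingHom.ker ((residue ↥(closureValuationSubring (w.adicCompletion F))).comp (τR τ)) =
        RingHom.ker ((residue ↥(closureValuationSubring (w.adicCompletion F))).comp (τR τ')) →
      RingHom.ker ((residue ↥(closureValuationSubring (w.adicCompletion F))).comp (τR τ)) ≠ w.asIdeal →
      RingHom.ker ((residue ↥(closureValuationSubring (w.adicCompletion F))).comp (τR τ)) ≠
        ((IsCMField.complexConj F) • w).asIdeal →
      m τ = m τ')
    (xbar : AlgPoints 𝓨.reductionAt (geomResidueField w)) (u : HeightOneSpectrum (𝓞 F))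
    (hpu : (p : 𝓞 F) ∈ u.asIdeal) (huw : u ≠ w) (huc : u ≠ (IsCMField.complexConj F) • w)
    (n : ℕ) ⦃T : SchemeOver (geomResidueField w)⦄
    (t : T ⟶ ((𝒜.baseChange (pullback.fst 𝓨.total.hom (specResidueField w))).baseChange
      (xbar.left : Spec (.of (geomResidueField w)) ⟶ pullback 𝓨.total.hom (specResidueField w))).X)
    (ht : ∀ b ∈ u.asIdeal ^ n, t ≫ ((act.baseChange (pullback.fst 𝓨.total.hom (specResidueField w))).baseChange
      (xbar.left : Spec (.of (geomResidueField w)) ⟶ pullback 𝓨.total.hom (specResidueField w))).i b = 1) :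
    letI ιs := pullback.fst 𝓨.total.hom (specResidueField w)
    letI xb : Spec (.of (geomResidueField w)) ⟶ pullback 𝓨.total.hom (specResidueField w) := xbar.left
    (t ≫ relFrobeniusOver p f ((𝒜.baseChange ιs).baseChange xb).X =
        (1 : T ⟶ ((((𝒜.baseChange ιs).baseChange xb)).baseChange (frobSpec (geomResidueField w) p f)).X) ↔
      ∀ b ∈ (∏ τ ∈ Finset.univ.filter (fun τ : F →+* AlgebraicClosure (w.adicCompletion F) =>
          m τ ≠ 0 ∧ RingHom.ker ((residue ↥(closureValuationSubring (w.adicCompletion F))).comp (τR τ)) ≠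
            (((IsCMField.complexConj F) • w).asIdeal : Ideal (𝓞 F))),
        RingHom.ker ((residue ↥(closureValuationSubring (w.adicCompletion F))).comp (τR τ))),
        t ≫ ((act.baseChange ιs).baseChange xb).i b = 1) := by
  classical
  -- (0) the special point, its instances, the point `p ≠ 0` in `𝓞 F`
  let ιs := pullback.fst 𝓨.total.hom (specResidueField w)
  let xb : Spec (.of (geomResidueField w)) ⟶ pullback 𝓨.total.hom (specResidueField w) := xbar.left
  haveI : IsLocallyNoetherian (Literature.AlgebraicGeometry.Motives.specOver w.asIdeal.ResidueField (geomResidueField w)).left :=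
    inferInstanceAs (IsLocallyNoetherian (Spec (CommRingCat.of (geomResidueField w))))
  haveI hcomm : IsCommMonObj (((𝒜.baseChange ιs).baseChange xb).X) := AbelianSchemeOver.isCommMonObj_of_isLocallyNoetherian_base _
  haveI : u.asIdeal.IsMaximal := u.isMaximal
  haveI : (((IsCMField.complexConj F) • u).asIdeal).IsMaximal := ((IsCMField.complexConj F) • u).isMaximal
  have hp0 : ((p : ℕ) : 𝓞 F) ≠ 0 := Nat.cast_ne_zero.2 (Fact.out : p.Prime).ne_zero
  -- (1) block data at `u` (★ (O-CRT))
  obtain ⟨e', 𝔟, he, hx, hcop⟩ := exists_eq_pow_mul_coprime u.isPrime u.ne_bot hp0 hpu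
  obtain ⟨a, ha1, ha2⟩ := exists_blockIdempotentFamily hcop e'
  -- (2) Kottwitz with roots in the valuation ring (the (S-T) `hK` currency), and `hone`
  haveI : IsProper 𝓨.total.hom := h𝓨.2
  have hKτ : ∀ (y : AlgPoints X (AlgebraicClosure (w.adicCompletion F))) (b : 𝓞 F),
      letI ιη := 𝓨.genericIso'.inv.left ≫ pullback.fst 𝓨.total.hom (specGenericPoint (valuationSubringAtPrime F w) F)
      haveI := ((act.baseChange ιη).baseChange y.left).isMonHom_i b
      (cotangentMap ((𝒜.baseChange ιη).baseChange y.left).toAffine.toAbelianVariety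
          (InducedCategory.homMk (Grp.ofHom (A := ((𝒜.baseChange ιη).baseChange y.left).X) (B := ((𝒜.baseChange ιη).baseChange y.left).X)
            (((act.baseChange ιη).baseChange y.left).i b)))).charpoly =
        ∏ τ ∈ (Finset.univ : Finset (F →+* AlgebraicClosure (w.adicCompletion F))),
          (Polynomial.X - Polynomial.C (algebraMap ↥(closureValuationSubring (w.adicCompletion F))
            (AlgebraicClosure (w.adicCompletion F)) (τR τ b))) ^ m τ := by
    intro y b
    rw [hK y b]
    exact Finset.prod_congr rfl fun τ _ => by rw [← hτR τ b]; rfl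
  have hone : ∀ τ : F →+* AlgebraicClosure (w.adicCompletion F), m τ = 1 →
      RingHom.ker ((residue ↥(closureValuationSubring (w.adicCompletion F))).comp (τR τ)) = w.asIdeal ∨
        RingHom.ker ((residue ↥(closureValuationSubring (w.adicCompletion F))).comp (τR τ)) = ((IsCMField.complexConj F) • w).asIdeal :=
    fun τ h1 => hone_of_banal w τR m hbanal τ h1
  by_cases h0 : ∀ τ : F →+* AlgebraicClosure (w.adicCompletion F),
      RingHom.ker ((residue ↥(closureValuationSubring (w.adicCompletion F))).comp (τR τ)) = u.asIdeal → m τ = 0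
  · -- (3) ÉTALE banal block: `𝔭_u^n ⊔ 𝔞_can = ⊤`, Lie rank `0`, the étale law
    have h𝔞 := pow_sup_prod_filter_ker_eq_top_of_forall_eq_zero w τR hτR m hpair hcount hone hw u huc h0 n
    have hsig0 : ∀ m', 0 < m' → haveI := ((act.baseChange ιs).baseChange xb).isMonHom
        Module.finrank (geomResidueField w) (LinearMap.range
          (AbelianVariety.cotangentMap ((𝒜.baseChange ιs).baseChange xb).toAffine.toAbelianVariety
            (InducedCategory.homMk (Grp.ofHom (A := ((𝒜.baseChange ιs).baseChange xb).X) (B := ((𝒜.baseChange ιs).baseChange xb).X)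
              (((act.baseChange ιs).baseChange xb).i (a m')))))) = 0 := fun m' hm' =>
      finrank_range_specialFibre_eq_zero_of_forall_ker_eq 𝓨 h𝓨 hg act he hx hcop a ha1 ha2 Finset.univ τR m (fun y => hKτ y (a 1))
        (fun τ _ hτ => h0 τ hτ) xbar m' hm'
    exact ((𝒜.baseChange ιs).baseChange xb).frobKernelBanal_of_lieSignature_zero ((act.baseChange ιs).baseChange xb) p he hx hcop a ha1
      ha2 hsig0 f n h𝔞 t ht
  · -- (4) MULTIPLICATIVE banal block
    push Not at h0
    obtain ⟨τ₀, hτ₀, hm0⟩ := h0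
    have h2 : ∀ τ : F →+* AlgebraicClosure (w.adicCompletion F),
        RingHom.ker ((residue ↥(closureValuationSubring (w.adicCompletion F))).comp (τR τ)) = u.asIdeal → m τ ≠ 0 :=
      forall_ne_zero_of_unmixed w τR m hunmixed u huw huc τ₀ hτ₀ hm0
    have h𝔞 : u.asIdeal ^ n ⊔
        (∏ τ ∈ Finset.univ.filter (fun τ : F →+* AlgebraicClosure (w.adicCompletion F) =>
            m τ ≠ 0 ∧ RingHom.ker ((residue ↥(closureValuationSubring (w.adicCompletion F))).comp (τR τ)) ≠
              (((IsCMField.complexConj F) • w).asIdeal : Ideal (𝓞 F))),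
          RingHom.ker ((residue ↥(closureValuationSubring (w.adicCompletion F))).comp (τR τ))) =
        u.asIdeal ^ n ⊔ Ideal.span {((p ^ f : ℕ) : 𝓞 F)} := by
      rw [pow_sup_prod_filter_ker_eq_of_forall_ne_zero w τR hτR m hpair hcount hone hw u huc h2 n,
        absNorm_asIdeal_eq_of_card_quotient_smul w hfDeg]
    -- complex conjugation on `𝓞 F` as a ring endomorphism, and the Rosati law in `star` form
    let star : 𝓞 F →+* 𝓞 F := MulSemiringAction.toRingHom (F ≃ₐ[↥(maximalRealSubfield F)] F) (𝓞 F) (IsCMField.complexConj F)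
    have hRos' : ∀ b, haveI := act.isMonHom b
        act.i (star b) ≫ pol.lam = pol.lam ≫ DualPair.dualIsogenyOver (act.i b) D D := fun b => hRos b (star b) rfl
    -- the signature VANISHES on the conjugate block `c • u`
    have h0c : ∀ τ : F →+* AlgebraicClosure (w.adicCompletion F),
        RingHom.ker ((residue ↥(closureValuationSubring (w.adicCompletion F))).comp (τR τ)) = ((IsCMField.complexConj F) • u).asIdeal →
          m τ = 0 :=
      forall_eq_zero_complexConj_smul_of_forall_ne_zero w τR hτR m hpair hbanal u huw huc h2
    -- block data of the conjugate family `star ∘ a` at `c • u` (★ `blockFamily_map`; `(c • u).asIdeal = u.asIdeal.map star` on the nose)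
    obtain ⟨hx', hcop', ha1', ha2'⟩ := blockFamily_map star hx hcop ha1 ha2
    have hsig0 : ∀ m', 0 < m' → haveI := ((act.baseChange ιs).baseChange xb).isMonHom
        Module.finrank (geomResidueField w) (LinearMap.range
          (AbelianVariety.cotangentMap ((𝒜.baseChange ιs).baseChange xb).toAffine.toAbelianVariety
            (InducedCategory.homMk (Grp.ofHom (A := ((𝒜.baseChange ιs).baseChange xb).X) (B := ((𝒜.baseChange ιs).baseChange xb).X)
              (((act.baseChange ιs).baseChange xb).i (star (a m'))))))) = 0 := fun m' hm' =>
      finrank_range_specialFibre_eq_zero_of_forall_ker_eq 𝓨 h𝓨 hg act (w' := ((IsCMField.complexConj F) • u).asIdeal) he hx' hcop'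
        (fun k => star (a k)) ha1' ha2' Finset.univ τR m (fun y => hKτ y (star (a 1))) (fun τ _ hτ => h0c τ hτ) xbar m' hm'
    -- the Rosati law and the (P-1) row at the special point (two base changes)
    have hRos₁ := rosati_baseChange ιs act D pol.lam star hRos'
    have hRos₀ : ∀ b, haveI := ((act.baseChange ιs).baseChange xb).isMonHom_i b
        ((act.baseChange ιs).baseChange xb).i (star b) ≫ ((pol.baseChange ιs).baseChange xb).lam =
          ((pol.baseChange ιs).baseChange xb).lam ≫
            DualPair.dualIsogenyOver (((act.baseChange ιs).baseChange xb).i b) ((D.baseChange ιs).baseChange xb) ((D.baseChange ιs).baseChange xb) :=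
      rosati_baseChange xb (act.baseChange ιs) (D.baseChange ιs) (pol.baseChange ιs).lam star hRos₁
    haveI := isMonHom_baseChangeHom (A := D.hat) (B := 𝒜) ν ιs
    haveI := isMonHom_baseChangeHom (A := (D.baseChange ιs).hat) (B := 𝒜.baseChange ιs) (baseChangeHom (A := D.hat) (B := 𝒜) ν ιs) xb
    have hν₁ : (pol.baseChange ιs).lam ≫ baseChangeHom (A := D.hat) (B := 𝒜) ν ιs = (𝒜.baseChange ιs).mulN d :=
      baseChangeHom_comp_eq_mulN ιs pol.lam ν hν
    have hν₀ : ((pol.baseChange ιs).baseChange xb).lam ≫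
        baseChangeHom (A := (D.baseChange ιs).hat) (B := 𝒜.baseChange ιs) (baseChangeHom (A := D.hat) (B := 𝒜) ν ιs) xb =
          ((𝒜.baseChange ιs).baseChange xb).mulN d :=
      baseChangeHom_comp_eq_mulN xb (pol.baseChange ιs).lam _ hν₁
    exact ((𝒜.baseChange ιs).baseChange xb).frobKernelBanal_of_conj_lieSignature_zero ((act.baseChange ιs).baseChange xb) p
      ((D.baseChange ιs).baseChange xb) ((pol.baseChange ιs).baseChange xb) star hRos₀ hf hpd _ hν₀ he hx hcop a ha1 ha2 hsig0 n h𝔞 t ht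

end Summit.HodgeConjecture.HodgeConjecture.Theorems.F0P6aFrobKernelBanalAtCanonicalTwistIdeal

end
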